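import Literature.MathematicalPhysics.QuantumManyBody.TorusSlotShiftDirichlet
import Summits.AtomisticToContinuum.BoseEinsteinCondensation.Theorems.BECConjugateDominationHardCoreExtensionCubeSaturation
-- module: Summits.AtomisticToContinuum.BoseEinsteinCondensation.Theorems.BECRewardDescentRewardChordBoundFreeRegionSpreadingHelpers

/-!
# Stub R3 `stub_freeRegionSpreading` of crux `RewardChordBound` (stmt-AtomisticToContinuum-12876), helpers I:
# slot hulls, the box dichotomy and the transport of ball masses along one-slot moves

Pure measure theory on the configuration torus `Ω = (ℝ/ℤ)^{N×3}` with a product probability measure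
`ℙ = Measure.pi (fun _ ↦ μ₁)`, `μ₁` a translation-invariant probability measure on `ℝ/ℤ` (for the stub: the Haar
probability measure `haarAddCircle`), slots `i : Fin N` moved by the one-slot shifts `σᵢ c`
(`BoseGas.slotShift i c`, `c ∈ (ℝ/ℤ)³`). For a measurable `Z ⊆ Ω` and a slot `i` the **slot hull**
`hullᵢ Z = {t | t + σᵢ c ∈ Z for μ₁³-a.e. c}` is measurable (`measurableSet_slotHull`), EXACTLY invariant under
every `σᵢ c` (`add_slotShift_mem_slotHull_iff`, translation invariance of `μ₁³`), and a.e. contained in `Z`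
(`measure_slotHull_diff_null`: Tonelli for `(t, c) ↦ 𝟙[t ∈ hull] 𝟙[t + σᵢc ∉ Z]` and invariance of `ℙ`).
If on a measurable set `U` the set `Z` is a.e. contained in each of its slot hulls (the saturation hypothesis of
the stub, `ℙ((U ∩ Z) \ hullᵢ Z) = 0`), then:

* `box_dichotomy` — on every coordinate box `∏ₚ A p ⊆ U`, `Z` is null or conull: the cube saturation lemma
  `measure_eq_zero_or_compl_of_saturated` of the hard-core kit over the `3N` coordinates (restricted measures,
  `Measure.restrict_pi_pi`), the saturation in the coordinate `(i, k)` being the exact invariance of `hullᵢ Z`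
  under `update x (i,k) y = x + σᵢ(single k (y - x(i,k)))` (`update_eq_add_slotShift`), null sets being a.e.
  invisible along a.e. fibre (`ae_ae_update_notMem`);
* `measure_ball_transport` — two sup-metric balls `B(C, ε)`, `B(C + σᵢc, ε) ⊆ U` carry the same `ℙ`-mass
  of `Z` and of `Zᶜ` (on `U`, `Z =ᵐ hullᵢ Z`, which is `σᵢc`-invariant, as is `ℙ`).

No new definitions: the slot hull is written out as `{t | ∀ᵐ c ∂μ₁³, t + σᵢ c ∈ Z}` throughout.
-/

noncomputable section

open MeasureTheory Filter Set Function Metric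
open scoped ENNReal NNReal Topology
open Literature.MathematicalPhysics.QuantumManyBody.BoseGas
open Summit.AtomisticToContinuum.BoseEinsteinCondensation.Cruxes.HardCoreExtension.ThirdLawCurrentFloorAlt

namespace Summit.AtomisticToContinuum.BoseEinsteinCondensation.Cruxes.RewardChordBound.Birth.FreeRegionSpreading

variable {N : ℕ}

section SlotHull

variable (μ₁ : Measure UnitAddCircle) [IsProbabilityMeasure μ₁] [μ₁.IsAddLeftInvariant]

/-- Updating the coordinate `(i, k)` is a one-slot shift of slot `i`. [folklore] -/
theorem update_eq_add_slotShift (x : UnitAddTorus (Fin N × Fin 3)) (i : Fin N) (k : Fin 3) (y : UnitAddCircle) :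
    Function.update x (i, k) y = x + slotShift i (Pi.single k (y - x (i, k))) := by
  ext ⟨j, k'⟩
  rw [Pi.add_apply]
  by_cases hj : j = i
  · subst hj
    by_cases hk : k' = k
    · subst hk
      rw [Function.update_self, slotShift_apply_same, Pi.single_eq_same]
      abel
    · rw [Function.update_of_ne (fun h => hk (Prod.ext_iff.1 h).2), slotShift_apply_same,
        Pi.single_eq_of_ne hk, add_zero]
  · rw [Function.update_of_ne (fun h => hj (Prod.ext_iff.1 h).1), slotShift_apply_of_ne hj, add_zero]

/-- Two one-slot shifts of the same slot compose to the one-slot shift by the sum. [folklore] -/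
theorem add_slotShift_add_slotShift (t : UnitAddTorus (Fin N × Fin 3)) (i : Fin N) (c₀ c : UnitAddTorus (Fin 3)) :
    t + slotShift i c₀ + slotShift i c = t + slotShift i (c₀ + c) := by
  rw [add_assoc]
  congr 1
  ext ⟨j, k⟩
  rw [Pi.add_apply]
  by_cases h : j = i
  · subst h
    simp only [slotShift_apply_same, Pi.add_apply]
  · simp only [slotShift_apply_of_ne h, add_zero]

/-- **The slot hull is invariant under the one-slot shifts of its slot**: `hullᵢ Z = {t | t + σᵢ c ∈ Z a.e. c}`
contains `t + σᵢ c₀` iff it contains `t` (translation invariance of the measure of `(ℝ/ℤ)³`). [folklore] -/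
theorem add_slotShift_mem_slotHull_iff (i : Fin N) (Z : Set (UnitAddTorus (Fin N × Fin 3)))
    (t : UnitAddTorus (Fin N × Fin 3)) (c₀ : UnitAddTorus (Fin 3)) :
    t + slotShift i c₀ ∈ {t : UnitAddTorus (Fin N × Fin 3) |
        ∀ᵐ c ∂(Measure.pi fun _ : Fin 3 => μ₁), t + slotShift i c ∈ Z} ↔
      t ∈ {t : UnitAddTorus (Fin N × Fin 3) | ∀ᵐ c ∂(Measure.pi fun _ : Fin 3 => μ₁), t + slotShift i c ∈ Z} := by
  simp only [mem_setOf_eq, add_slotShift_add_slotShift]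
  exact eventually_add_left_iff (Measure.pi fun _ : Fin 3 => μ₁) c₀ (p := fun c => t + slotShift i c ∈ Z)

omit [μ₁.IsAddLeftInvariant] in
/-- The slot hull of a measurable set is measurable. [folklore] -/
theorem measurableSet_slotHull {Z : Set (UnitAddTorus (Fin N × Fin 3))} (hZ : MeasurableSet Z) (i : Fin N) :
    MeasurableSet {t : UnitAddTorus (Fin N × Fin 3) |
      ∀ᵐ c ∂(Measure.pi fun _ : Fin 3 => μ₁), t + slotShift i c ∈ Z} := by
  set E : Set (UnitAddTorus (Fin N × Fin 3) × UnitAddTorus (Fin 3)) := {x | x.1 + slotShift i x.2 ∉ Z} with hE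
  have hEm : MeasurableSet E := (measurable_fst.add ((measurable_slotShift i).comp measurable_snd)) hZ.compl
  have hm : Measurable fun t : UnitAddTorus (Fin N × Fin 3) => (Measure.pi fun _ : Fin 3 => μ₁) (Prod.mk t ⁻¹' E) :=
    measurable_measure_prodMk_left hEm
  have hset : {t : UnitAddTorus (Fin N × Fin 3) | ∀ᵐ c ∂(Measure.pi fun _ : Fin 3 => μ₁), t + slotShift i c ∈ Z} =
      (fun t : UnitAddTorus (Fin N × Fin 3) => (Measure.pi fun _ : Fin 3 => μ₁) (Prod.mk t ⁻¹' E)) ⁻¹' {0} := by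
    ext t
    simp only [mem_setOf_eq, mem_preimage, mem_singleton_iff, ae_iff]
    rfl
  rw [hset]
  exact hm (measurableSet_singleton 0)

/-- **The slot hull lies a.e. inside the set**: `ℙ(hullᵢ Z \ Z) = 0` (Tonelli for
`(t, c) ↦ 𝟙[t ∈ hull] 𝟙[t + σᵢc ∉ Z]`, invariance of the hull and of the product measure under `σᵢc`).
[folklore] -/
theorem measure_slotHull_diff_null {Z : Set (UnitAddTorus (Fin N × Fin 3))} (hZ : MeasurableSet Z) (i : Fin N) :
    Measure.pi (fun _ : Fin N × Fin 3 => μ₁)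
      ({t : UnitAddTorus (Fin N × Fin 3) | ∀ᵐ c ∂(Measure.pi fun _ : Fin 3 => μ₁), t + slotShift i c ∈ Z} \ Z) = 0 := by
  set H : Set (UnitAddTorus (Fin N × Fin 3)) :=
    {t | ∀ᵐ c ∂(Measure.pi fun _ : Fin 3 => μ₁), t + slotShift i c ∈ Z} with hH
  have hHm : MeasurableSet H := measurableSet_slotHull μ₁ hZ i
  set F : UnitAddTorus (Fin N × Fin 3) → UnitAddTorus (Fin 3) → ℝ≥0∞ :=
    fun t c => H.indicator 1 t * Zᶜ.indicator 1 (t + slotShift i c) with hF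
  have hFm : Measurable (uncurry F) := by
    refine Measurable.mul ?_ ?_
    · exact (measurable_one.indicator hHm).comp measurable_fst
    · exact (measurable_one.indicator hZ.compl).comp
        (measurable_fst.add ((measurable_slotShift i).comp measurable_snd))
  -- (1) the iterated integral vanishes
  have h1 : ∀ t, ∫⁻ c, F t c ∂(Measure.pi fun _ : Fin 3 => μ₁) = 0 := by
    intro t
    by_cases ht : t ∈ H
    · have ht' : ∀ᵐ c ∂(Measure.pi fun _ : Fin 3 => μ₁), t + slotShift i c ∈ Z := ht
      have hae : ∀ᵐ c ∂(Measure.pi fun _ : Fin 3 => μ₁), F t c = 0 := by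
        filter_upwards [ht'] with c hc
        simp only [hF, Set.indicator_of_notMem (fun h : t + slotShift i c ∈ Zᶜ => h hc), mul_zero]
      rw [lintegral_congr_ae hae, lintegral_zero]
    · simp only [hF, Set.indicator_of_notMem ht, zero_mul, lintegral_zero]
  have h2 : ∫⁻ t, ∫⁻ c, F t c ∂(Measure.pi fun _ : Fin 3 => μ₁) ∂(Measure.pi fun _ : Fin N × Fin 3 => μ₁) = 0 := by
    rw [lintegral_congr fun t => h1 t, lintegral_zero]
  -- (2) swap the integrals
  rw [lintegral_lintegral_swap hFm.aemeasurable] at h2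
  -- (3) the inner integral in `t` is the constant `ℙ(hull \ Z)`
  have h3 : ∀ c, ∫⁻ t, F t c ∂(Measure.pi fun _ : Fin N × Fin 3 => μ₁) =
      Measure.pi (fun _ : Fin N × Fin 3 => μ₁) (H \ Z) := by
    intro c
    have hG : ∀ t, F t c = (H ∩ Zᶜ).indicator (1 : UnitAddTorus (Fin N × Fin 3) → ℝ≥0∞) (t + slotShift i c) := by
      intro t
      simp only [hF, inter_indicator_one, Pi.mul_apply]
      congr 1
      by_cases ht : t ∈ H
      · rw [Set.indicator_of_mem ht, Set.indicator_of_mem ((add_slotShift_mem_slotHull_iff μ₁ i Z t c).2 ht),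
          Pi.one_apply, Pi.one_apply]
      · rw [Set.indicator_of_notMem ht,
          Set.indicator_of_notMem (fun h => ht ((add_slotShift_mem_slotHull_iff μ₁ i Z t c).1 h))]
    simp_rw [hG]
    rw [lintegral_add_right_eq_self (μ := Measure.pi fun _ : Fin N × Fin 3 => μ₁)
      (fun t => (H ∩ Zᶜ).indicator (1 : UnitAddTorus (Fin N × Fin 3) → ℝ≥0∞) t) (slotShift i c),
      lintegral_indicator_one (hHm.inter hZ.compl), Set.sdiff_eq]
  simp_rw [h3] at h2
  rw [lintegral_const, measure_univ, mul_one] at h2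
  exact h2

end SlotHull

section BoxDichotomy

/-- **Null sets are a.e. invisible along a.e. fibre**: on a finite product of finite measure spaces, if `D` is null
then for every coordinate `i` and a.e. `x`, the fibre `y ↦ update x i y` avoids `D` for a.e. `y`. [folklore] -/
theorem ae_ae_update_notMem {ι : Type*} [Fintype ι] [DecidableEq ι] {X : ι → Type*} [∀ i, MeasurableSpace (X i)]
    (μ : ∀ i, Measure (X i)) [∀ i, IsFiniteMeasure (μ i)] {D : Set (∀ i, X i)} (hD : MeasurableSet D)
    (hD0 : Measure.pi μ D = 0) (i : ι) :
    ∀ᵐ x ∂Measure.pi μ, ∀ᵐ y ∂μ i, Function.update x i y ∉ D := by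
  have hind : Measurable (D.indicator (1 : (∀ i, X i) → ℝ≥0∞)) := measurable_one.indicator hD
  have h := lintegral_lmarginal_singleton μ i hind
  rw [lintegral_indicator_one hD, hD0, mul_zero, lintegral_eq_zero_iff (hind.lmarginal μ)] at h
  filter_upwards [h] with x hx
  rw [lmarginal_singleton] at hx
  have hm' : Measurable fun y => D.indicator (1 : (∀ i, X i) → ℝ≥0∞) (Function.update x i y) :=
    hind.comp (measurable_update _)
  simp only [Pi.zero_apply] at hx
  rw [lintegral_eq_zero_iff hm'] at hx
  filter_upwards [hx] with y hy
  intro hyD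
  simp [Set.indicator_of_mem hyD] at hy

variable (μ₁ : Measure UnitAddCircle) [IsProbabilityMeasure μ₁] [μ₁.IsAddLeftInvariant]

/-- **Box dichotomy.** Let `Z` be measurable and `U` measurable such that on `U` the set `Z` is a.e. contained in
each of its slot hulls. Then on every coordinate box `∏ₚ A p ⊆ U`, `Z` is null or conull: cube saturation over
the `3N` coordinates, the saturation in the coordinate `(i, k)` coming from the exact invariance of the slot hull
`hullᵢ Z` under the shifts of slot `i`. [folklore] -/
theorem box_dichotomy {Z U : Set (UnitAddTorus (Fin N × Fin 3))} (hZ : MeasurableSet Z) (hUm : MeasurableSet U)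
    (hU : ∀ i : Fin N, Measure.pi (fun _ : Fin N × Fin 3 => μ₁) ((U ∩ Z) \
      {t : UnitAddTorus (Fin N × Fin 3) | ∀ᵐ c ∂(Measure.pi fun _ : Fin 3 => μ₁), t + slotShift i c ∈ Z}) = 0)
    (A : Fin N × Fin 3 → Set UnitAddCircle) (hA : ∀ p, MeasurableSet (A p)) (hAU : Set.pi univ A ⊆ U) :
    Measure.pi (fun _ : Fin N × Fin 3 => μ₁) (Set.pi univ A ∩ Z) = 0 ∨
      Measure.pi (fun _ : Fin N × Fin 3 => μ₁) (Set.pi univ A \ Z) = 0 := by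
  have hpi : Measure.pi (fun p => μ₁.restrict (A p)) =
      (Measure.pi fun _ : Fin N × Fin 3 => μ₁).restrict (Set.pi univ A) := (Measure.restrict_pi_pi _ A).symm
  have key := measure_eq_zero_or_compl_of_saturated (fun p => μ₁.restrict (A p)) hZ ?_
  · rw [hpi, Measure.restrict_apply hZ, Measure.restrict_apply hZ.compl, inter_comm, inter_comm Zᶜ, ← Set.sdiff_eq]
      at key
    exact key
  rintro ⟨i, k⟩
  set H : Set (UnitAddTorus (Fin N × Fin 3)) :=
    {t | ∀ᵐ c ∂(Measure.pi fun _ : Fin 3 => μ₁), t + slotShift i c ∈ Z} with hH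
  have hHm : MeasurableSet H := measurableSet_slotHull μ₁ hZ i
  set D : Set (UnitAddTorus (Fin N × Fin 3)) := ((U ∩ Z) \ H) ∪ (H \ Z) with hD
  have hDm : MeasurableSet D := ((hUm.inter hZ).diff hHm).union (hHm.diff hZ)
  have hD0 : Measure.pi (fun _ : Fin N × Fin 3 => μ₁) D = 0 :=
    measure_union_null (hU i) (measure_slotHull_diff_null μ₁ hZ i)
  have hD0' : Measure.pi (fun p => μ₁.restrict (A p)) D = 0 := by
    rw [hpi]
    exact nonpos_iff_eq_zero.1 ((Measure.restrict_apply_le _ _).trans hD0.le)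
  have hL1 := ae_ae_update_notMem (fun p => μ₁.restrict (A p)) hDm hD0' (i, k)
  have hbox : ∀ᵐ x ∂Measure.pi (fun p => μ₁.restrict (A p)), x ∈ Set.pi univ A := by
    rw [hpi]
    exact ae_restrict_mem (MeasurableSet.univ_pi hA)
  have hAk : ∀ᵐ y ∂μ₁.restrict (A (i, k)), y ∈ A (i, k) := ae_restrict_mem (hA _)
  filter_upwards [hL1, hbox] with x hxD hxA
  have hupd_box : ∀ y ∈ A (i, k), Function.update x (i, k) y ∈ Set.pi univ A := by
    intro y hy p _
    by_cases hp : p = (i, k)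
    · subst hp
      rw [Function.update_self]
      exact hy
    · rw [Function.update_of_ne hp]
      exact hxA p (mem_univ p)
  have hupd_hull : ∀ y, Function.update x (i, k) y ∈ H ↔ x ∈ H := fun y => by
    rw [update_eq_add_slotShift, hH, add_slotShift_mem_slotHull_iff]
  by_cases hx : x ∈ H
  · left
    filter_upwards [hxD, hAk] with y hyD _hyA
    by_contra hyZ
    exact hyD (Or.inr ⟨(hupd_hull y).2 hx, hyZ⟩)
  · right
    filter_upwards [hxD, hAk] with y hyD hyA hyZ
    exact hyD (Or.inl ⟨⟨hAU (hupd_box y hyA), hyZ⟩, fun h => hx ((hupd_hull y).1 h)⟩)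

/-- **Transport along a one-slot move.** Under the hypotheses of `box_dichotomy`, two balls `B(C, ε)` and
`B(C + σᵢc, ε)` inside `U` carry the same mass of `Z` and of `Zᶜ`: on `U`, `Z` agrees a.e. with the slot hull
`hullᵢ Z` (and `Zᶜ` with its complement), which are invariant under `σᵢc`, as is the product measure. [folklore] -/
theorem measure_ball_transport {Z U : Set (UnitAddTorus (Fin N × Fin 3))} (hZ : MeasurableSet Z)
    (hU : ∀ i : Fin N, Measure.pi (fun _ : Fin N × Fin 3 => μ₁) ((U ∩ Z) \
      {t : UnitAddTorus (Fin N × Fin 3) | ∀ᵐ c ∂(Measure.pi fun _ : Fin 3 => μ₁), t + slotShift i c ∈ Z}) = 0)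
    {C : UnitAddTorus (Fin N × Fin 3)} {ε : ℝ} (i : Fin N) (c : UnitAddTorus (Fin 3)) (h1 : ball C ε ⊆ U)
    (h2 : ball (C + slotShift i c) ε ⊆ U) :
    Measure.pi (fun _ : Fin N × Fin 3 => μ₁) (ball C ε ∩ Z) =
        Measure.pi (fun _ : Fin N × Fin 3 => μ₁) (ball (C + slotShift i c) ε ∩ Z) ∧
      Measure.pi (fun _ : Fin N × Fin 3 => μ₁) (ball C ε \ Z) =
        Measure.pi (fun _ : Fin N × Fin 3 => μ₁) (ball (C + slotShift i c) ε \ Z) := by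
  set H : Set (UnitAddTorus (Fin N × Fin 3)) :=
    {t | ∀ᵐ c ∂(Measure.pi fun _ : Fin 3 => μ₁), t + slotShift i c ∈ Z} with hH
  have hcongr : ∀ B : Set (UnitAddTorus (Fin N × Fin 3)), B ⊆ U →
      Measure.pi (fun _ : Fin N × Fin 3 => μ₁) (B ∩ Z) = Measure.pi (fun _ : Fin N × Fin 3 => μ₁) (B ∩ H) ∧
        Measure.pi (fun _ : Fin N × Fin 3 => μ₁) (B \ Z) = Measure.pi (fun _ : Fin N × Fin 3 => μ₁) (B \ H) := by
    intro B hB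
    constructor
    · refine measure_congr (ae_eq_set.2 ⟨?_, ?_⟩)
      · refine measure_mono_null (fun t ht => ?_) (hU i)
        exact ⟨⟨hB ht.1.1, ht.1.2⟩, fun htH => ht.2 ⟨ht.1.1, htH⟩⟩
      · refine measure_mono_null (fun t ht => ?_) (measure_slotHull_diff_null μ₁ hZ i)
        exact ⟨ht.1.2, fun htZ => ht.2 ⟨ht.1.1, htZ⟩⟩
    · refine measure_congr (ae_eq_set.2 ⟨?_, ?_⟩)
      · refine measure_mono_null (fun t ht => ?_) (measure_slotHull_diff_null μ₁ hZ i)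
        exact ⟨Classical.by_contradiction fun htH => ht.2 ⟨ht.1.1, htH⟩, ht.1.2⟩
      · refine measure_mono_null (fun t ht => ?_) (hU i)
        exact ⟨⟨hB ht.1.1, Classical.by_contradiction fun htZ => ht.2 ⟨ht.1.1, htZ⟩⟩, ht.1.2⟩
  have htrans : ∀ V : Set (UnitAddTorus (Fin N × Fin 3)), (∀ t c', t + slotShift i c' ∈ V ↔ t ∈ V) →
      Measure.pi (fun _ : Fin N × Fin 3 => μ₁) (ball C ε ∩ V) =
        Measure.pi (fun _ : Fin N × Fin 3 => μ₁) (ball (C + slotShift i c) ε ∩ V) := by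
    intro V hV
    have hset : ball C ε ∩ V = (fun t => t + slotShift i c) ⁻¹' (ball (C + slotShift i c) ε ∩ V) := by
      ext t
      simp only [mem_inter_iff, mem_preimage, mem_ball, dist_add_right, hV]
    rw [hset, measure_preimage_add_right]
  obtain ⟨e1, e2⟩ := hcongr _ h1
  obtain ⟨e3, e4⟩ := hcongr _ h2
  refine ⟨?_, ?_⟩
  · rw [e1, e3]
    exact htrans _ (fun t c' => add_slotShift_mem_slotHull_iff μ₁ i Z t c')
  · rw [e2, e4, Set.sdiff_eq, Set.sdiff_eq]
    exact htrans _ (fun t c' => not_congr (add_slotShift_mem_slotHull_iff μ₁ i Z t c'))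

end BoxDichotomy

end Summit.AtomisticToContinuum.BoseEinsteinCondensation.Cruxes.RewardChordBound.Birth.FreeRegionSpreading

namespace Summit.AtomisticToContinuum.BoseEinsteinCondensation.Cruxes.RewardChordBound.Birth

/-- **Sub-goal `stub_freeRegionSpreadingBoxDichotomy` of stub R3** (registered helper of `stub_freeRegionSpreading`,
the Haar case `μ₁ = haarAddCircle` of `FreeRegionSpreading.box_dichotomy`): a measurable `Z ⊆ (ℝ/ℤ)^{N×3}` which on a
measurable `U` is a.e. contained in each of its slot hulls `{t | t + σᵢ c ∈ Z for a.e. c}` is null or conull on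
every coordinate box `∏ₚ A p ⊆ U`. [folklore] -/
theorem stub_freeRegionSpreadingBoxDichotomy :
    ∀ (N : ℕ) (Z U : Set (UnitAddTorus (Fin N × Fin 3))), MeasurableSet Z → MeasurableSet U → (∀ i : Fin N, (MeasureTheory.Measure.pi fun _ : Fin N × Fin 3 => (AddCircle.haarAddCircle : MeasureTheory.Measure UnitAddCircle)) ((U ∩ Z) \ {t : UnitAddTorus (Fin N × Fin 3) | ∀ᵐ c ∂(MeasureTheory.Measure.pi fun _ : Fin 3 => (AddCircle.haarAddCircle : MeasureTheory.Measure UnitAddCircle)), t + Literature.MathematicalPhysics.QuantumManyBody.BoseGas.slotShift i c ∈ Z}) = 0) → ∀ A : Fin N × Fin 3 → Set UnitAddCircle, (∀ p, MeasurableSet (A p)) → Set.pi Set.univ A ⊆ U → (MeasureTheory.Measure.pi fun _ : Fin N × Fin 3 => (AddCircle.haarAddCircle : MeasureTheory.Measure UnitAddCircle)) (Set.pi Set.univ A ∩ Z) = 0 ∨ (MeasureTheory.Measure.pi fun _ : Fin N × Fin 3 => (AddCircle.haarAddCircle : MeasureTheory.Measure UnitAddCircle)) (Set.pi Set.univ A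 \ Z) = 0 :=
  fun _ _ _ hZ hU h A hA hAU => FreeRegionSpreading.box_dichotomy AddCircle.haarAddCircle hZ hU h A hA hAU

end Summit.AtomisticToContinuum.BoseEinsteinCondensation.Cruxes.RewardChordBound.Birth

end
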